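import Summits.ResolutionOfSingularities.ResolutionOfSingularities.Theorems.RadicialJungCleanModelsSufficeGameLocal

/-!
# Route `RadicialJung`, crux `CleanModelsSuffice`, line `Sketch`: the exceptionalisation game —
# the PHASE-1 CENTRE `{mOld = μ}` is closed and admissible (`stub_gameCentre1`)

Closes the registered stub `stub_gameCentre1` of the skeleton of
`Summit.ResolutionOfSingularities.ResolutionOfSingularities.Theses.RadicialJung.CleanModelsSuffice`
(stmt-ResolutionOfSingularities-15883). In a game state `S` with `mOld ≤ μ` everywhere (`μ ≥ 2`),
near every point `v` (`GameState.exists_nhds_mOld_eq_iff`, from `GameState.exists_nhds_mOld_eq` of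
`…GameLocal`):

  `mOld w = μ ⟺ (mOld v = μ ∧ every old charged coordinate divisor cl(η_i) of v passes through w)`
  `        ⟺ (mOld v = μ ∧ η_{oldCh v} ⤳ w)`.

Hence `{mOld = μ}` is closed (its complement is open) and its germ at a point `v` of it is the
coordinate prime of the old charged coordinates, `I(Z)_v = (u_i : i ∈ oldCh v)`
(`stalkIdeal_vanishingIdeal_eq_span_of_nhds`), generated by `|oldCh v| = μ ≥ 2` charged coordinates:
the centre is `S.Admissible`. The `K(V)`-algebra structure on `L` is transported along the
birational `π` as in `…ReductionKN`.
-/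

noncomputable section

set_option linter.dupNamespace false -- mandated namespace of this single-conjunct summit

open CategoryTheory AlgebraicGeometry TopologicalSpace IsLocalRing
open Literature.AlgebraicGeometry.Resolution Literature.AlgebraicGeometry.Motives
open Summit.ResolutionOfSingularities.ResolutionOfSingularities.Theorems.Picover

namespace Summit.ResolutionOfSingularities.ResolutionOfSingularities.Theorems.RadicialJung.CleanModelsSuffice

attribute [local instance] stalkAlgebra isScalarTower_stalkAlgebra

namespace GameState

variable {p : ℕ} {V₀ : Scheme.{0}} [IsIntegral V₀] {L : Type} [Field L] [Algebra V₀.functionField L]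
  {V : Scheme.{0}} [IsIntegral V] {π : V ⟶ V₀} [IsDominant π]
  (S : GameState p V₀ L V π) [Algebra V.functionField L]
  (hp : p.Prime) (k : Type) [Field k] [CharP k p] (f : V ⟶ Spec (.of k)) [LocallyOfFiniteType f]
  (hdegV : Module.finrank V.functionField L = p)
  (hrange : Set.range (algebraMap V.functionField L) = Set.range (algebraMap V₀.functionField L))
  (hcompat : ∀ g : V₀.functionField,
    algebraMap V.functionField L (RatFn.functionFieldMap π g) = algebraMap V₀.functionField L g)

include hp f hdegV hrange hcompat in
open Classical in
/-- **The phase-1 centre near a point.** If `mOld ≤ μ` everywhere and `μ ≥ 2`, every `v` has an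
open neighbourhood `U` on which `mOld w = μ ↔ (mOld v = μ ∧ η_{oldCh v} ⤳ w)`. [folklore] -/
theorem exists_nhds_mOld_eq_iff (μ : ℕ) (hμ : 2 ≤ μ) (hle : ∀ v, S.mOld v ≤ μ) (v : V) :
    ∃ U : V.Opens, v ∈ U ∧ ∀ w ∈ U, (S.mOld w = μ ↔ (S.mOld v = μ ∧ S.gen v (S.oldCh v) ⤳ w)) := by
  classical
  obtain ⟨U₁, hvU₁, hU₁⟩ := S.exists_nhds_mOld_eq hp k f hdegV hrange hcompat v
  obtain ⟨U₂, hvU₂, hU₂⟩ := S.exists_nhds_card_charged_eq hp k f hdegV hrange hcompat v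
  obtain ⟨U₃, hvU₃, hU₃⟩ := S.exists_nhds_gen_specializes_iff k f v (S.oldCh v)
  refine ⟨U₁ ⊓ U₂ ⊓ U₃, ⟨⟨hvU₁, hvU₂⟩, hvU₃⟩, fun w hw => ?_⟩
  obtain ⟨⟨hw₁, hw₂⟩, hw₃⟩ := hw
  rw [hU₃ w hw₃]
  set o : Finset (Fin (S.d v)) := (S.oldCh v).filter fun i => S.gen v {i} ⤳ w with ho
  have ho_le : o.card ≤ S.mOld v := Finset.card_filter_le _ _
  have ho_le' : o.card ≤ ((S.ch v).filter fun i => S.gen v {i} ⤳ w).card := by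
    refine Finset.card_le_card fun i hi => ?_
    obtain ⟨hi, hgen⟩ := Finset.mem_filter.mp hi
    exact Finset.mem_filter.mpr ⟨(Finset.mem_filter.mp hi).1, hgen⟩
  -- `|ch w| = mOld w + #{D charged at w} ≥ mOld w`
  have hsum := S.card_oldCh_add_card_filter_isLab w
  have hmOldw : S.mOld w = (S.oldCh w).card := rfl
  have hmOldv : S.mOld v = (S.oldCh v).card := rfl
  constructor
  · intro hwμ
    have h2 : 2 ≤ (S.ch w).card := by rw [← hsum, ← hmOldw, hwμ]; omega
    have heq := hU₁ w hw₁ (Or.inl h2)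
    rw [hwμ] at heq
    have hvμ : S.mOld v = μ := le_antisymm (hle v) (heq ▸ ho_le)
    refine ⟨hvμ, fun i hi => ?_⟩
    have hfull : o = S.oldCh v := Finset.eq_of_subset_of_card_le (Finset.filter_subset _ _)
      (by rw [← hmOldv, hvμ, heq])
    have hio : i ∈ o := by rw [hfull]; exact hi
    exact (Finset.mem_filter.mp hio).2
  · rintro ⟨hvμ, hall⟩
    have hfull : o = S.oldCh v := Finset.filter_true_of_mem hall
    have hoμ : o.card = μ := by rw [hfull, ← hmOldv, hvμ]
    have h2 : 2 ≤ ((S.ch v).filter fun i => S.gen v {i} ⤳ w).card := by omega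
    rw [hU₁ w hw₁ (Or.inr h2), ← ho, hoμ]

end GameState

/-! ## The registered stub -/

/-- **`stub_gameCentre1` (phase-1 centre of the exceptionalisation game).** In a game state with
at most `μ` old charged components through any point (`μ ≥ 2`), the locus `{mOld = μ}` is closed
and is, at each of its points, the coordinate subspace of the old charged coordinates (an
admissible centre): transport the `K(V)`-algebra structure of `L` along the birational `π`, then
`GameState.exists_nhds_mOld_eq_iff` gives closedness and
`GameState.stalkIdeal_vanishingIdeal_eq_span_of_nhds` the germ `I(Z)_v = (u_i : i ∈ oldCh v)`.
[folklore] -/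
theorem stub_gameCentre1 (p : ℕ) (hp : p.Prime) (k : Type) [Field k] [CharP k p]
    (V₀ : Scheme.{0}) [IsIntegral V₀] (f₀ : V₀ ⟶ Spec (.of k)) (L : Type) [Field L]
    [Algebra V₀.functionField L] [LocallyOfFiniteType f₀] [QuasiCompact f₀]
    (hdeg : Module.finrank V₀.functionField L = p)
    (V : Scheme.{0}) [IsIntegral V] (π : V ⟶ V₀) [IsDominant π] [IsProper π] (hbir : IsBirational π)
    (S : GameState p V₀ L V π) (μ : ℕ) (hμ : 2 ≤ μ) (hle : ∀ v, S.mOld v ≤ μ) :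
    ∃ hZ : IsClosed {v | S.mOld v = μ}, S.Admissible {v | S.mOld v = μ} hZ (fun v _ => S.oldCh v) := by
  classical
  -- adapted from `hasResolution_normalizationIn_of_adaptedModelKN` (`…ReductionKN`): `L` over `K(V)`
  have hbij : Function.Bijective (RatFn.functionFieldMap π) :=
    TowerTransport.bijective_functionFieldMap_of_isIso π hbir.isIso_stalkMap_genericPoint
  let eK : V₀.functionField ≃+* V.functionField := RingEquiv.ofBijective _ hbij
  have heK : ∀ x, eK x = RatFn.functionFieldMap π x := fun _ => rfl
  letI : Algebra V.functionField L :=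
    ((algebraMap V₀.functionField L).comp eK.symm.toRingHom).toAlgebra
  have halg : algebraMap V.functionField L =
      (algebraMap V₀.functionField L).comp eK.symm.toRingHom := rfl
  have hcompat : ∀ g : V₀.functionField,
      algebraMap V.functionField L (RatFn.functionFieldMap π g) = algebraMap V₀.functionField L g := by
    intro g
    rw [halg, RingHom.comp_apply, ← heK]
    exact congrArg (algebraMap V₀.functionField L) (eK.symm_apply_apply g)
  have hrange : Set.range (algebraMap V.functionField L) =
      Set.range (algebraMap V₀.functionField L) := by
    ext z
    constructor
    · rintro ⟨x, rfl⟩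
      exact ⟨eK.symm x, by rw [halg]; rfl⟩
    · rintro ⟨x, rfl⟩
      exact ⟨RatFn.functionFieldMap π x, hcompat x⟩
  have hdegV : Module.finrank V.functionField L = p := by
    rw [← hdeg]
    exact Algebra.finrank_eq_of_equiv_equiv eK.symm (RingEquiv.refl L) (by ext x; simp [halg])
  let f : V ⟶ Spec (.of k) := π ≫ f₀
  haveI : LocallyOfFiniteType f := inferInstance
  -- the local description of `Z = {mOld = μ}`
  choose U hvU hU using S.exists_nhds_mOld_eq_iff hp k f hdegV hrange hcompat μ hμ hle
  have hZ : IsClosed {v : V | S.mOld v = μ} := by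
    rw [← isOpen_compl_iff, isOpen_iff_forall_mem_open]
    intro v hv
    exact ⟨U v, fun w hw hwZ => hv ((hU v w hw).mp hwZ).1, (U v).isOpen, hvU v⟩
  refine ⟨hZ, ⟨fun v hv => ?_, fun v _ => Finset.filter_subset _ _, fun v hv => ?_⟩⟩
  · change 2 ≤ S.mOld v
    rw [show S.mOld v = μ from hv]
    exact hμ
  · have hvμ : S.mOld v = μ := hv
    exact S.stalkIdeal_vanishingIdeal_eq_span_of_nhds v (S.oldCh v) hZ (U v) (hvU v)
      fun w hw => (hU v w hw).trans (and_iff_right hvμ)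

end Summit.ResolutionOfSingularities.ResolutionOfSingularities.Theorems.RadicialJung.CleanModelsSuffice

end
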